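import Mathlib
import Literature.Analysis.FluidPDE.TypeIAncientMild
import Literature.Analysis.FluidPDE.TypeIAncientMildDecay
import Literature.Analysis.FluidPDE.AxisymmetricEuler
import Literature.Analysis.FluidPDE.SelfSimilar
import Literature.Analysis.FluidPDE.PineauVicolAngularMean
import Literature.Analysis.FluidPDE.OctahedralSymmetry
import Summits.NavierStokesRegularity.NavierStokesRegularity.Theorems.ScenarioCensusAncientPlanarTypeI
import HarnessLib.Audit
import HarnessLib

/-!
# Blow-up scenario census — block A annex (route-independent): row A9e (effective large-order
# Liouville, "order meter")

Cell `pub/ns-census` (`SCENARIO-CENSUS.md` v1.25/v1.26, seat ns-census-lead g3).  Block A's main files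
`ScenarioCensusAncient.lean` (398 l.) / `ScenarioCensusAncientSymmetry.lean` are full; the A-block rows
whose closers sit in the `DssFarFieldSlaving` cone are indexed in `ScenarioCensusRotatingCone.lean`
(row A9′ = `Row_A9p`, `Row_A9pMild`).  This annex is CONE-FREE (Literature imports only), so that a
wave-2 line attaching to a row typed here can import it without entering any route's cone.

## Row A9e (booked by the lead 09:22Z as a CANDIDATE under row A9′; typed here VERBATIM from the
## ideator card, `pub/ideators/ns-idea-2/lines/order-meter/line-order-meter.lean:118`, ns-idea-2 g8)

(Type I in the KNSS/Oseen gauge `IsTypeIAncientMild M V`, ANY time constant `M` · space constant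
`‖x‖ ‖V(t,x)‖ ≤ A` · first-order decay constant `(‖x‖ + √(−t))² ‖DV(t,·)(x)‖ ≤ C₁` (a THEOREM of the
class for SOME `C₁`, `IsTypeIAncientMild.gaugeBounds_of_hasTypeIDecay`, here a parameter) · slices
`m`-fold symmetric about `e₃`, `V(t, R_{2π/m} x) = R_{2π/m} V(t,x)`, with the EXPLICIT threshold
`m ≥ 8 + 4A + 8√C₁`): `V ≡ 0` on `t < 0`.  NO self-similarity.  Row A9′ (`Row_A9p`,
EXCLUDED-IN-TREE by compactness + KNSS 2009 Thm 5.3, threshold `m₀(C₀)` INEFFECTIVE) is its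
qualitative shadow; A9e is the EFFECTIVE sub-cell.  Value on typing: OPEN (the lead's words rule:
OPEN-NO-LINE until a line is registered; ideator line «order-meter»: projected similarity enstrophy +
angular Hardy + KNSS 5.3, three stubs).  Nothing is asserted: `@[conjecture]` obligation node.

No summit statement is proved here; nothing in this file is a claim about NS regularity.
-/

noncomputable section

-- the summit and its single problem share the name `NavierStokesRegularity` (D-0017 nested layout)
set_option linter.dupNamespace false

open MeasureTheory Set Filter Topology
open scoped ENNReal NNReal

namespace Summit.NavierStokesRegularity.NavierStokesRegularity.Theorems.ScenarioCensus

open Literature.Analysis Literature.Analysis.FluidPDE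

/-- **Row A9e** (Type I, KNSS gauge `IsTypeIAncientMild M V`, any `M` · space constant `A` ·
first-order decay constant `C₁` · `m`-fold rotational symmetry of every slice about `e₃` with
`m ≥ 8 + 4A + 8√C₁`): `V(t,x) = 0` for all `t < 0`, `x` — the EFFECTIVE large-order Liouville
statement ("order meter"), sub-cell of row A9′ (`Row_A9p`, threshold ineffective).  Typed VERBATIM
from the ideator card «order-meter» (ns-idea-2 g8, `line-order-meter.lean:118`); OPEN — nothing
asserted.  (For `m = 0` the symmetry hypothesis is vacuous but the threshold excludes it.)
(refs: KochNadirashviliSereginSverak2009 §1 (L), Thm 5.3; census `SCENARIO-CENSUS.md` row A9′/A9e)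
[cite: KochNadirashviliSereginSverak2009, §1 conjecture (L) and Thm 5.3 (arXiv:0709.3599)] -/
@[conjecture] def Row_A9e : Prop :=
  ∀ (M A C₁ : ℝ) (m : ℕ), 0 ≤ A → 0 ≤ C₁ → 8 + 4 * A + 8 * Real.sqrt C₁ ≤ (m : ℝ) →
    ∀ V : ℝ → EuclideanSpace ℝ (Fin 3) → EuclideanSpace ℝ (Fin 3), IsTypeIAncientMild M V →
      (∀ t < 0, ∀ x, ‖x‖ * ‖V t x‖ ≤ A) →
      (∀ t < 0, ∀ x, (‖x‖ + Real.sqrt (-t)) ^ (1 + 1) * ‖iteratedFDeriv ℝ 1 (V t) x‖ ≤ C₁) →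
      (∀ t < 0, ∀ x : EuclideanSpace ℝ (Fin 3),
        V t (rotZ (2 * Real.pi / m) x) = rotZ (2 * Real.pi / m) (V t x)) →
        ∀ t < 0, ∀ x, V t x = 0

/-- Monotonicity in the threshold data: row A9e at constants `(A, C₁)` contains every cell with
smaller constants `A' ≤ A`, `C₁' ≤ C₁` at the SAME order `m` (the hypotheses weaken; the threshold
`8 + 4A + 8√C₁ ≤ m` only gets easier) — recorded as the census's sub-cell relation, nothing asserted
about A9e itself. [cite: KochNadirashviliSereginSverak2009, §1 (arXiv:0709.3599)] -/
theorem row_A9e_mono_constants (h : Row_A9e) (M A A' C₁ C₁' : ℝ) (m : ℕ) (hA' : 0 ≤ A')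
    (hC₁' : 0 ≤ C₁') (hAA : A' ≤ A) (hCC : C₁' ≤ C₁) (hm : 8 + 4 * A + 8 * Real.sqrt C₁ ≤ (m : ℝ))
    (V : ℝ → EuclideanSpace ℝ (Fin 3) → EuclideanSpace ℝ (Fin 3)) (hV : IsTypeIAncientMild M V)
    (hA : ∀ t < 0, ∀ x, ‖x‖ * ‖V t x‖ ≤ A')
    (hC : ∀ t < 0, ∀ x, (‖x‖ + Real.sqrt (-t)) ^ (1 + 1) * ‖iteratedFDeriv ℝ 1 (V t) x‖ ≤ C₁')
    (hsym : ∀ t < 0, ∀ x : EuclideanSpace ℝ (Fin 3),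
      V t (rotZ (2 * Real.pi / m) x) = rotZ (2 * Real.pi / m) (V t x)) :
    ∀ t < 0, ∀ x, V t x = 0 := by
  have hm' : 8 + 4 * A' + 8 * Real.sqrt C₁' ≤ (m : ℝ) := by
    have h1 : Real.sqrt C₁' ≤ Real.sqrt C₁ := Real.sqrt_le_sqrt hCC
    linarith
  exact h M A' C₁' m hA' hC₁' hm' V hV hA hC hsym

/-! ## Appended 2026-08-28 (typer-1 g4, lead g4 ORDER 09:44Z 1–2/4): rows A13 and A8th
## (ideator ns-idea-3 «thin-period», `pub/ideators/ns-idea-3/lines/thin-period/line-thin-period.lean`,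
## sha16 67a46a16a7e1c273; bodies VERBATIM, re-keyed into the census namespace)

Only the two CELLS and their position in the census lattice are typed here (sorry-free glue BY NAME);
the line's obligations T1 `ThinPeriodRigidity` / T2 `FluctuationPropagation` / R
`AxialMeanRepresentative` and its compositions `row_A8t_of`, `row_A8Thin_of` are LINE CONTENT and are
NOT typed (a LEAD registers the skeleton).  This keeps the file cone-free: the only Summits imports are
the cone-free census modules `ScenarioCensusAncientPlanarTypeI` (→ `…PlanarSymmetry` →
`…AncientSymmetry` → `Theorems.LiouvilleConjectureNS`). -/

/-! ### Vocabulary (verbatim `line-thin-period.lean` :115 / :119, `e3` spelled out) -/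

/-- A slice `v : ℝ³ → ℝ³` is `P`-periodic along the axis `e₃` (pointwise):
`v (x + P e₃) = v x` (thin-period line, :115). [folklore] -/
def IsZPeriodic (P : ℝ) (v : EuclideanSpace ℝ (Fin 3) → EuclideanSpace ℝ (Fin 3)) : Prop :=
  ∀ x, v (x + P • EuclideanSpace.single 2 (1 : ℝ)) = v x

/-- A slice is invariant under EVERY axial translation, almost everywhere (the `z`-fluctuation
vanishes; thin-period line, :119). [folklore] -/
def AeZInvariant (v : EuclideanSpace ℝ (Fin 3) → EuclideanSpace ℝ (Fin 3)) : Prop :=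
  ∀ δ : ℝ, (fun x => v (x + δ • EuclideanSpace.single 2 (1 : ℝ))) =ᵐ[volume] v

/-! ### Row A13 — periodic time-Type-I Liouville (no symmetry) -/

/-- **Row A13** (TIME-only Type I `‖u(t,x)‖ ≤ C/√(−t)` · `P`-PERIODIC along the axis at every `t < 0`,
any `P > 0` · NO symmetry · ancient mild, duality form `ν = 1`, measurable slices): every slice is a.e.
constant.  VERBATIM `PeriodicTypeILiouville` of the thin-period line (:181).  Sharp in the sense of
A7c/A8t (the spatially constant `C(−t)^{−1/2} e₃`-type members forbid "`u ≡ 0`").  Lattice (all BY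
NAME below): A7c ⊂ A13 (`row_A7c_of_row_A13`), A8t ⊂ A13 (`row_A8t_of_row_A13`: a helical slice of
pitch `h ≠ 0` is `2π|h|`-periodic), A13 ⊂ A1 = (L) (`row_A13_of_liouvilleConjectureNS`).  OPEN — nothing
asserted. [cite: KochNadirashviliSereginSverak2009, §1 conjecture (L) and Thm 5.1 (arXiv:0709.3599)] -/
@[conjecture] def Row_A13 : Prop :=
  ∀ P : ℝ, 0 < P →
    ∀ u : ℝ → EuclideanSpace ℝ (Fin 3) → EuclideanSpace ℝ (Fin 3), FluidPDE.IsAncientMildSolution 1 u →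
      (∀ t < 0, AEStronglyMeasurable (u t) volume) → (∀ t < 0, IsZPeriodic P (u t)) →
        (∃ C : ℝ, FluidPDE.HasTypeITimeDecay C u) →
          ∀ t < 0, ∃ b : EuclideanSpace ℝ (Fin 3), u t =ᵐ[volume] fun _ => b

/-! ### Row A8th — bounded helical ancient mild, SMALL period–Reynolds number (rung toward A8) -/

/-- **Row A8th** (bounded ancient mild, duality form `ν = 1`, measurable slices · HELICAL of pitch
`h ≠ 0` · SMALL period–Reynolds number `2π|h| · ‖u‖_∞ ≤ c₀` for some absolute `c₀ > 0`): every slice is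
a.e. constant.  VERBATIM `Row_A8Thin` of the thin-period line (:191); `Row_A8` = this cell ∪ its
complement `Re_P > c₀`.  An honest sub-cell of A8 (`row_A8th_of_row_A8`).  OPEN — nothing asserted.
[cite: KochNadirashviliSereginSverak2009, §1 conjecture (L) and Thm 5.1 (arXiv:0709.3599)] -/
@[conjecture] def Row_A8th : Prop :=
  ∃ c₀ : ℝ, 0 < c₀ ∧ ∀ h : ℝ, h ≠ 0 →
    ∀ u : ℝ → EuclideanSpace ℝ (Fin 3) → EuclideanSpace ℝ (Fin 3),
      FluidPDE.IsBoundedAncientMildSolution 1 u → (∀ t < 0, AEStronglyMeasurable (u t) volume) →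
        (∀ t < 0, ∀ (θ : ℝ) (x : EuclideanSpace ℝ (Fin 3)),
            u t (FluidPDE.rotZ θ x + (h * θ) • EuclideanSpace.single 2 (1 : ℝ)) =
              FluidPDE.rotZ θ (u t x)) →
          (∃ U : ℝ, (∀ t < 0, ∀ x, ‖u t x‖ ≤ U) ∧ 2 * Real.pi * |h| * U ≤ c₀) →
            ∀ t < 0, ∃ b : EuclideanSpace ℝ (Fin 3), u t =ᵐ[volume] fun _ => b

/-! ### Proved glue (from the line file; `R_{±2π} = id` are `FluidPDE.rotZ_two_pi` / `rotZ_neg_two_pi`): helical ⇒ `2π|h|`-periodic -/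

/-- A helical slice of pitch `h ≠ 0` is `2π|h|`-periodic along the axis (one full turn, in the
direction making the axial advance positive; thin-period line :215). [folklore] -/
theorem isZPeriodic_of_helical {h : ℝ} (hh : h ≠ 0)
    {v : EuclideanSpace ℝ (Fin 3) → EuclideanSpace ℝ (Fin 3)}
    (hv : ∀ (θ : ℝ) (x : EuclideanSpace ℝ (Fin 3)),
      v (FluidPDE.rotZ θ x + (h * θ) • EuclideanSpace.single 2 (1 : ℝ)) = FluidPDE.rotZ θ (v x)) :
    IsZPeriodic (2 * Real.pi * |h|) v := by
  intro x
  rcases lt_or_gt_of_ne hh with hneg | hpos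
  · have key := hv (-(2 * Real.pi)) x
    rw [FluidPDE.rotZ_neg_two_pi, FluidPDE.rotZ_neg_two_pi] at key
    have habs : 2 * Real.pi * |h| = h * (-(2 * Real.pi)) := by
      rw [abs_of_neg hneg]; ring
    rw [habs]
    exact key
  · have key := hv (2 * Real.pi) x
    rw [FluidPDE.rotZ_two_pi, FluidPDE.rotZ_two_pi] at key
    have habs : 2 * Real.pi * |h| = h * (2 * Real.pi) := by
      rw [abs_of_pos hpos]; ring
    rw [habs]
    exact key

/-- The period `2π|h|` of a helical field of pitch `h ≠ 0` is positive. [folklore] -/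
theorem twoPi_mul_abs_pitch_pos {h : ℝ} (hh : h ≠ 0) : 0 < 2 * Real.pi * |h| :=
  mul_pos (mul_pos two_pos Real.pi_pos) (abs_pos.2 hh)

/-- The constant of a Type-I time rate is non-negative. [folklore] -/
theorem hasTypeITimeDecay_const_nonneg {u : ℝ → EuclideanSpace ℝ (Fin 3) → EuclideanSpace ℝ (Fin 3)}
    {C : ℝ} (hC : FluidPDE.HasTypeITimeDecay C u) : 0 ≤ C := by
  have h := hC (-1) (by norm_num) 0
  have h1 : Real.sqrt (-(-1 : ℝ)) = 1 := by norm_num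
  rw [h1, div_one] at h
  exact (norm_nonneg _).trans h

/-- Under the Type-I time rate, `u` is bounded by `C/√(−t)` on the whole slab `(−∞, t]`. [folklore] -/
theorem hasTypeITimeDecay_slab_bound {u : ℝ → EuclideanSpace ℝ (Fin 3) → EuclideanSpace ℝ (Fin 3)}
    {C : ℝ} (hC : FluidPDE.HasTypeITimeDecay C u) {t : ℝ} (ht : t < 0) :
    ∀ s ≤ t, ∀ x, ‖u s x‖ ≤ C / Real.sqrt (-t) := by
  intro s hs x
  have hs0 : s < 0 := lt_of_le_of_lt hs ht
  refine (hC s hs0 x).trans ?_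
  exact div_le_div_of_nonneg_left (hasTypeITimeDecay_const_nonneg hC) (Real.sqrt_pos.2 (by linarith))
    (Real.sqrt_le_sqrt (by linarith))

/-! ### Position of A13 / A8th in the census lattice (BY NAME): A7c ⊂ A13, A8t ⊂ A13, A13 ⊂ A1; A8th ⊂ A8 -/

/-- **A13 ⇒ A8t**: a helical slice of pitch `h ≠ 0` is `2π|h|`-periodic, so the periodic time-Type-I cell
contains row A8t (`Row_A8t`, `ScenarioCensusAncientSymmetry.lean`). [folklore] -/
theorem row_A8t_of_row_A13 (hL : Row_A13) : Row_A8t := by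
  intro h hh u hu hmeas hhel hdec t ht
  exact hL (2 * Real.pi * |h|) (twoPi_mul_abs_pitch_pos hh) u hu hmeas
    (fun s hs => isZPeriodic_of_helical hh (hhel s hs)) hdec t ht

/-- **A13 ⇒ A7c**: a `z`-invariant slice is periodic of every period, so the periodic cell contains the
EXCLUDED row A7c (`Row_A7c`, `ScenarioCensusAncientPlanarTypeI.lean`) — A13 sits strictly above
something proved. [folklore] -/
theorem row_A7c_of_row_A13 (hL : Row_A13) : Row_A7c := by
  intro u hu hmeas hinv hdec t ht
  exact hL 1 one_pos u hu hmeas (fun s hs x => hinv s hs x 1) hdec t ht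

/-- **(L) ⇒ A13**: below the leaf A1 = (L) (`LiouvilleConjectureNS`, ⟨10661⟩): the time-shifted field
`v(τ) = u(τ + t/2)` is a bounded ancient mild solution; periodicity is carried, not used.
[cite: KochNadirashviliSereginSverak2009, §1 conjecture (L) (arXiv:0709.3599)] -/
theorem row_A13_of_liouvilleConjectureNS
    (hL : Summit.NavierStokesRegularity.NavierStokesRegularity.LiouvilleConjectureNS) : Row_A13 := by
  intro P _ u hu hmeas _ hdec t ht
  obtain ⟨C, hC⟩ := hdec
  set s : ℝ := t / 2 with hs_def
  have hs : s < 0 := by rw [hs_def]; linarith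
  set v : ℝ → EuclideanSpace ℝ (Fin 3) → EuclideanSpace ℝ (Fin 3) := fun τ => u (τ + s) with hv_def
  have hv : FluidPDE.IsBoundedAncientMildSolution 1 v := by
    refine ⟨hu.time_translate hs.le, C / Real.sqrt (-s), fun τ hτ x => ?_⟩
    have hτ' : τ < 0 := mem_Iio.1 hτ
    exact hasTypeITimeDecay_slab_bound hC hs (τ + s) (by linarith) x
  have hvmeas : ∀ τ < 0, AEStronglyMeasurable (v τ) volume := fun τ hτ => hmeas (τ + s) (by linarith)
  obtain ⟨b, hb⟩ := hL v hv hvmeas (t - s) (by rw [hs_def]; linarith)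
  refine ⟨b, ?_⟩
  have : v (t - s) = u t := by simp [hv_def]
  rw [this] at hb
  exact hb

/-- **A8 ⇒ A8th**: the rung is an honest sub-cell of row A8 (`Row_A8`, `ScenarioCensusAncientSymmetry.lean`;
the smallness hypothesis is carried, not used). [folklore] -/
theorem row_A8th_of_row_A8 (h8 : Row_A8) : Row_A8th :=
  ⟨1, one_pos, fun h hh u hu hmeas hhel _ => h8 h hh u hu hmeas hhel⟩

/-- Sanity (non-vacuity of the vocabulary): constant slices are periodic of every period and a.e.
invariant under every axial translation. [folklore] -/
theorem const_isZPeriodic_aeZInvariant (b : EuclideanSpace ℝ (Fin 3)) (P : ℝ) :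
    IsZPeriodic P (fun _ => b) ∧ AeZInvariant (fun _ => b) :=
  ⟨fun _ => rfl, fun _ => EventuallyEq.rfl⟩

/-! ## Appended 2026-08-28 (typer-1 g4, lead g4 ORDER 09:54Z [1/2]): row A9i — irreducible finite
## symmetry × KNSS-gauge Type I × space window (ideator ns-idea-2 «platonic-window»,
## `pub/ideators/ns-idea-2/lines/platonic-window/line-platonic-window.lean` :76 / :95, bodies VERBATIM)

Only the vocabulary `IsIrreducibleSet`, the cell `Row_A9i`, its narrower window `Row_A9i'` (`A ≤ 3/2`)
and the window monotonicity are typed; the line's obligations (`StretchYoung`, `LowModesVanish`,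
`ModalHardy`) and `row_A9i_of_stubs` are LINE CONTENT and are not typed.  The no-symmetry anchor
`A ≤ 1/2` is the coned tree theorem `SimilarityEnstrophy.typeI_ancient_eq_zero_of_spaceConstant_le_half`
(indexed in the cone file, not here). -/

/-- A set `G` of linear isometries of `ℝ³` acts IRREDUCIBLY: there is no common invariant line, i.e. no
`v ≠ 0` with `g v = v ∨ g v = −v` for every `g ∈ G` (platonic-window line :76; examples: generators of
the rotation groups `T`, `O`, `I`). [folklore] -/
def IsIrreducibleSet
    (G : Set (EuclideanSpace ℝ (Fin 3) ≃ₗᵢ[ℝ] EuclideanSpace ℝ (Fin 3))) : Prop :=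
  ∀ v : EuclideanSpace ℝ (Fin 3), (∀ g ∈ G, g v = v ∨ g v = -v) → v = 0

/-- **Row A9i** (IRREDUCIBLE finite symmetry: slices equivariant under an irreducibly acting set `G` of
linear isometries · KNSS-gauge Type I `IsTypeIAncientMild M V`, any `M` · space window
`‖x‖ ‖V(t,x)‖ ≤ A` with `A ≤ 5/2`): `V ≡ 0` on `t < 0`.  VERBATIM `Row_A9i` of the platonic-window line
(:95).  Without symmetry the tree has the window `A ≤ 1/2`
(`SimilarityEnstrophy.typeI_ancient_eq_zero_of_spaceConstant_le_half`); the line proposes that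
irreducibility (no `ℓ = 0, 1` spherical modes) widens it to `5/2` (modal Hardy).  OPEN — nothing asserted.
[cite: KochNadirashviliSereginSverak2009, §1 conjecture (L) and Thm 5.3 (arXiv:0709.3599)] -/
@[conjecture] def Row_A9i : Prop :=
  ∀ (M A : ℝ) (G : Set (EuclideanSpace ℝ (Fin 3) ≃ₗᵢ[ℝ] EuclideanSpace ℝ (Fin 3))),
    IsIrreducibleSet G → A ≤ 5 / 2 →
    ∀ V : ℝ → EuclideanSpace ℝ (Fin 3) → EuclideanSpace ℝ (Fin 3), IsTypeIAncientMild M V →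
      (∀ t < 0, ∀ x, ‖x‖ * ‖V t x‖ ≤ A) →
      (∀ g ∈ G, ∀ t < 0, ∀ x, V t (g x) = g (V t x)) →
        ∀ t < 0, ∀ x, V t x = 0

/-- **Row A9i′** (the same cell with the NARROWER window `A ≤ 3/2`): the intermediate rung between the
no-symmetry anchor `A ≤ 1/2` and the line's `5/2`.  OPEN — nothing asserted; implied by `Row_A9i`
(`row_A9i'_of_row_A9i`). [cite: KochNadirashviliSereginSverak2009, §1 conjecture (L) and Thm 5.3 (arXiv:0709.3599)] -/
@[conjecture] def Row_A9i' : Prop :=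
  ∀ (M A : ℝ) (G : Set (EuclideanSpace ℝ (Fin 3) ≃ₗᵢ[ℝ] EuclideanSpace ℝ (Fin 3))),
    IsIrreducibleSet G → A ≤ 3 / 2 →
    ∀ V : ℝ → EuclideanSpace ℝ (Fin 3) → EuclideanSpace ℝ (Fin 3), IsTypeIAncientMild M V →
      (∀ t < 0, ∀ x, ‖x‖ * ‖V t x‖ ≤ A) →
      (∀ g ∈ G, ∀ t < 0, ∀ x, V t (g x) = g (V t x)) →
        ∀ t < 0, ∀ x, V t x = 0

/-- **Window monotonicity**: the wide window `A ≤ 5/2` (row A9i) contains the narrow one `A ≤ 3/2`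
(row A9i′). [folklore] -/
theorem row_A9i'_of_row_A9i (h : Row_A9i) : Row_A9i' :=
  fun M A G hG hA V hV hAV hsym => h M A G hG (hA.trans (by norm_num)) V hV hAV hsym

/-! ## Appended 2026-08-28 (typer-1 g4, lead g4 WORD 10:36Z): row A9o — the octahedral (Kida) rung of the
## window family (ideator ns-idea-2 «platonic-window» rev 3, `line-platonic-window.lean` :354, VERBATIM)

`IsOhEquivariant` is the tree's `Literature.Analysis.FluidPDE.IsOhEquivariant` (`OctahedralSymmetry.lean`
:476; Elgindi–Jeong 2021 Def. 1.1; the 48-element group `O_h` realised by the standard octahedral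
isometries — conjugate realisations reduce to it by rotating `V`, ref RULING 10:36Z).  Only the cell is
typed; the line's obligations (S1, S2a″ `LowModesZero3`, S2b″ `ModalHardy4`) and the class-level twins
`OhTypeIWindow` / `OhTypeIDssLiouvilleWindow` (crux ⟨1536⟩ `CirculationRelay.OhTypeIDssLiouville`
restricted to `C₀ ≤ 9/2`) are line content and are NOT typed here (the latter would need the
CirculationRelay cone). -/

/-- **Row A9o** («octahedral (Kida) window»: slices `O_h`-equivariant, `IsOhEquivariant (V t)` · KNSS-gauge
Type I `IsTypeIAncientMild M V`, any `M` · space window `‖x‖ ‖V(t,x)‖ ≤ A` with `A ≤ 9/2`): `V ≡ 0` on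
`t < 0`.  VERBATIM `Row_A9o` of the platonic-window line rev 3 (:354); the `O_h` rung of the family
A9iHalf (`A ≤ 1/2`, EXCLUDED) ⊂ A9i′ (`3/2`) ⊂ A9i (`5/2`) ⊂ A9o (`9/2`, mode floor `ℓ ≥ 4`).  Parent A9i;
class-level twin = crux ⟨1536⟩ restricted to `C₀ ≤ 9/2`.  OPEN — nothing asserted; not in print (nearest:
Brandolese, Math. Ann. 329 (2004) Thm 1.2, forward polyhedral DECAY, not Liouville).
[cite: KochNadirashviliSereginSverak2009, §1 conjecture (L) and Thm 5.3 (arXiv:0709.3599)] -/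
@[conjecture] def Row_A9o : Prop :=
  ∀ (M A : ℝ), A ≤ 9 / 2 →
    ∀ V : ℝ → EuclideanSpace ℝ (Fin 3) → EuclideanSpace ℝ (Fin 3), IsTypeIAncientMild M V →
      (∀ t < 0, ∀ x, ‖x‖ * ‖V t x‖ ≤ A) → (∀ t < 0, IsOhEquivariant (V t)) →
        ∀ t < 0, ∀ x, V t x = 0

/-- **A9o ⇒ A9i restricted to `O_h`**: an `O_h`-equivariant field is equivariant under the irreducibly
acting set of octahedral isometries, so at any window `A ≤ 5/2 ≤ 9/2` row A9o contains the `O_h` instance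
of row A9i — recorded in the weakest glue form: A9o at window `9/2` implies the `O_h`-equivariant case of
the A9i′ window `3/2` and of the A9i window `5/2` (monotonicity in `A`). [folklore] -/
theorem row_A9o_window_mono (h : Row_A9o) (M A : ℝ) (hA : A ≤ 5 / 2)
    (V : ℝ → EuclideanSpace ℝ (Fin 3) → EuclideanSpace ℝ (Fin 3)) (hV : IsTypeIAncientMild M V)
    (hAV : ∀ t < 0, ∀ x, ‖x‖ * ‖V t x‖ ≤ A) (hOh : ∀ t < 0, IsOhEquivariant (V t)) :
    ∀ t < 0, ∀ x, V t x = 0 :=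
  h M A (hA.trans (by norm_num)) V hV hAV hOh

end Summit.NavierStokesRegularity.NavierStokesRegularity.Theorems.ScenarioCensus

end
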